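import Literature.AnabelianGeometry.AbsoluteAnabelian.MonoidKummerMapsProp32iPresentationIndep
import Literature.AnabelianGeometry.AbsoluteAnabelian.AbsTopIII.ReconstructionCor110OpenInjectiveProofs
import HarnessLib

/-!
# [AbsTopIII] Prop. 3.2 (i), Rmk. 3.2.2: the index clause along an ARBITRARY injective open homomorphism
# `G ↪ G*` of arithmetic Galois groups — the Prop. 3.2 (i) twin of the Cor. 1.10 (i) open-injective theorem

S. Mochizuki, *Topics in Absolute Anabelian Geometry III*, Def. 3.1 (ii) p. 70 (a morphism of `𝒞^MLF_TM` lies over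
an «open injective homomorphism» `G → G*`), Prop. 3.2 (i) p. 71, Rmk. 3.2.2 p. 73 l. 21–28 («the functoriality of
Proposition 3.2, (i), when applied to the isomorphism `H²(G, μ_Ẑ(M_TM)) ⥲ Ẑ`, is to be understood in the sense of a
"compatibility", relative to dividing the "`Ẑ`" … by a factor given by the index of the image of the induced open
homomorphism on arithmetic Galois groups»); kurims render `url-5493eb38cbb7`.

abc-iut cell, layer L4 (abc-iut-L4-d3; the Prop. 3.2 (i) twin of row «COR110i-OPEN-INJ»).  The tree has the index
clause of the `h2Iso` of the Kummer theory OF RECORD along the FIELD restriction `G_{k′} ↪ G_k` at THE characterised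
identifications (abc-iut-w4-d045 `galH2EquivZhat_galCyclotomeRes_datum` / `kummerTheoryStd_h2Iso_galCyclotomeRes_datum`,
`MonoidKummerMapsProp32iIndexTransfer.lean`) and presentation/chart independence (`MonoidKummerMapsProp32iPresentationIndep.lean`);
the general Def. 3.1 (ii) morphism `β : G ↪ G*` was covered «in principle» (`β = Inn(g) ∘ res ∘ iso`,
`exists_eq_conj_absGaloisRestrict_comp`).  This PROOF-ONLY file states it LITERALLY, over abc-iut-L4-d3's
`galCyclotomeResOE β` (`GaloisCyclotomeResOpenEmbedding.lean`): since the `h2Iso` of record at THE datum IS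
`Cor110iaNat.residueIso` (`galH2EquivZhat_iso_eq_residueIso` / `kummerTheoryStd_h2Iso_iso_eq_residueIso`, rfl), the
open-injective index formula `Cor110iaNat.residueIso_galCyclotomeResOE` transfers verbatim:

* `galH2EquivZhat_galCyclotomeResOE_datum` — for EVERY injective open `β : G_{k₁} ↪ G_k` of absolute Galois groups of
  MLFs, `galH2EquivZhat_{k₁}(H²(i_{k₁})(Res_β x)) = [G_k : β(G_{k₁})] • galH2EquivZhat_k(H²(i_k) x)`;
* `kummerTheoryStd_h2Iso_galCyclotomeResOE_datum` — the same for the Kummer theories of record of two model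
  presentations `π`, `π₁` whose arithmetic Galois groups are related by an arbitrary injective open `β`.

Theorems only (no definition, no named fact, no `sorry`); axioms standard.  HONEST FRAMING: classical LCFT/Kummer theory;
model-presented ≠ node-level; nothing here bears on [IUTchIII] Cor. 3.12 or takes a side.
-/

noncomputable section

open CategoryTheory Function
open Field ValuativeRel
open ProfiniteGrp ProfiniteGrp.ProfiniteCompletion

namespace Literature.AnabelianGeometry.AbsoluteAnabelian

open _root_.TopRep _root_.ContRepresentation _root_.ContinuousCohomology
open Literature.NumberTheory.GaloisRepresentations
open Literature.NumberTheory.GaloisRepresentations.DiscreteGaloisModule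
open Literature.AnabelianGeometry.EtaleTheta Literature.AnabelianGeometry.EtaleTheta.ZHatLevel

section Datum

variable (k : Type) [Field k] [ValuativeRel k] [TopologicalSpace k] [IsNonarchimedeanLocalField k] [CharZero k]
  (k₁ : Type) [Field k₁] [ValuativeRel k₁] [TopologicalSpace k₁] [IsNonarchimedeanLocalField k₁] [CharZero k₁]
  (β : absoluteGaloisGroup k₁ →ₜ* absoluteGaloisGroup k) (hinj : Injective β) (hopen : IsOpen (Set.range β))

/-- **Rmk. 3.2.2 along an ARBITRARY injective open homomorphism `β : G_{k₁} ↪ G_k`, at THE characterised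
identifications — unconditional**: abc-iut-L4-t2's `galH2EquivZhat` at `k₁` of `H²(i_{k₁})(Res_β x)` is
`[G_k : β(G_{k₁})]` times `galH2EquivZhat` at `k` of `H²(i_k) x` («dividing by the index of the image»), where
`Res_β = galCyclotomeResOE β 2` is the restriction on the cohomology of the group-theoretic cyclotomes.
[cite: MochizukiAbsTopIII2015, Remark 3.2.2 p.73] -/
theorem galH2EquivZhat_galCyclotomeResOE_datum (x : galCyclotomeH2 (absoluteGaloisGroup k)) :
    ((MLFClosure.std k₁).galH2EquivZhat
        ((cohomologyMap (Cor110iaNat.iso k₁).hom 2).hom ((galCyclotomeResOE β hinj hopen 2).hom x))).down =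
      β.toMonoidHom.range.index •
        ((MLFClosure.std k).galH2EquivZhat ((cohomologyMap (Cor110iaNat.iso k).hom 2).hom x)).down := by
  rw [galH2EquivZhat_iso_eq_residueIso, galH2EquivZhat_iso_eq_residueIso]
  exact Cor110iaNat.residueIso_galCyclotomeResOE k k₁ β hinj hopen x

end Datum

section Presentations

variable {P P₁ : GaloisMonoidPair.{0}} (π : P.ModelPresentation) (π₁ : P₁.ModelPresentation)
  (R : TorsionReciprocityData π.C.k) (R₁ : TorsionReciprocityData π₁.C.k)
  (β : absoluteGaloisGroup π₁.C.k →ₜ* absoluteGaloisGroup π.C.k) (hinj : Injective β)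
  (hopen : IsOpen (Set.range β))

/-- **Rmk. 3.2.2 for the Kummer theories of record of two presented abstract MLF-Galois `TM`-pairs whose arithmetic
Galois groups are related by an ARBITRARY injective open homomorphism `β : G₁ ↪ G`** (the Galois leg of a general
morphism of `𝒞^MLF_TM`, Def. 3.1 (ii)), at THE characterised identifications — unconditional:
`h2Iso_{π₁}(H²(i_{k₁})(Res_β x)) = [G : β(G₁)] • h2Iso_π(H²(i_k) x)` in `Ẑ`. [cite: MochizukiAbsTopIII2015, Remark 3.2.2 p.73] -/
theorem kummerTheoryStd_h2Iso_galCyclotomeResOE_datum (x : galCyclotomeH2 (absoluteGaloisGroup π.C.k)) :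
    ((π₁.kummerTheoryStd R₁).h2Iso
        ((cohomologyMap (Cor110iaNat.iso π₁.C.k).hom 2).hom ((galCyclotomeResOE β hinj hopen 2).hom x))).down =
      β.toMonoidHom.range.index •
        ((π.kummerTheoryStd R).h2Iso ((cohomologyMap (Cor110iaNat.iso π.C.k).hom 2).hom x)).down := by
  rw [kummerTheoryStd_h2Iso_iso_eq_residueIso, kummerTheoryStd_h2Iso_iso_eq_residueIso]
  exact Cor110iaNat.residueIso_galCyclotomeResOE π.C.k π₁.C.k β hinj hopen x

/-- **Presentation-, datum- and chart-free form**: for an abstract topological group chart-free statement, combine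
with `kummerTheoryStd_h2Iso_chart_independent`; here the FIELD-RESTRICTION special case is recovered: at
`β = res : G_{k′} ↪ G_k` the index is `[k′ : k]` (`galCyclotomeRes_eq_galCyclotomeResOE`, rfl, and abc-iut-L4-d3's
`exists_eq_conj_absGaloisRestrict_comp` for the index of the image).
[cite: MochizukiAbsTopIII2015, Remark 3.2.2 p.73] -/
theorem kummerTheoryStd_h2Iso_galCyclotomeRes_datum' [Algebra π.C.k π₁.C.k] [FiniteDimensional π.C.k π₁.C.k]
    (x : galCyclotomeH2 (absoluteGaloisGroup π.C.k)) :
    ((π₁.kummerTheoryStd R₁).h2Iso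
        ((cohomologyMap (Cor110iaNat.iso π₁.C.k).hom 2).hom ((galCyclotomeRes π.C.k π₁.C.k 2).hom x))).down =
      (absGaloisRestrict π.C.k π₁.C.k).toMonoidHom.range.index •
        ((π.kummerTheoryStd R).h2Iso ((cohomologyMap (Cor110iaNat.iso π.C.k).hom 2).hom x)).down := by
  rw [galCyclotomeRes_eq_galCyclotomeResOE]
  exact kummerTheoryStd_h2Iso_galCyclotomeResOE_datum π π₁ R R₁ _ _ _ x

end Presentations

end Literature.AnabelianGeometry.AbsoluteAnabelian
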